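import Summits.BirchSwinnertonDyer.Rank1Residual.X1.MuLambdaAlgebra
import Literature.NumberTheory.EllipticCurves.AdditiveReductionSemistableModelProofs
import HarnessLib

/-!
# The SLOPE PINCH in `Λ = ℤ_p⟦T⟧` (pure algebra): a cofactor forced to be a unit by the `p`-adic
# valuations of the first three coefficients of the product

HONEST FRAMING (cell `bsd-2adic`, run/shared/lean/pub/bsd-2adic/, seat `bsd-2adic-mult-3` GEN 9, HUMAN RULINGS
D-0036 / D-0054 / D-0074 row (A)): research route; THEOREMS ONLY (pure commutative algebra over `ℤ_p`, Mathlib + the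
tree's `X1.MuLambda` API and two `ℤ_p`-valuation lemmas of `Literature…AdditiveReductionSemistableModelProofs`) — no definition, no named fact, nothing asserted, nothing booked; BSD is not proved by any
of this. Route-free (no `Theses` import); consumed by the slope-pinch door
`Theorems/ByReductionTypeAtTwoMultSlopePinch.lean` (items 19923 / 19922 at the class 412830t).

## What is proved

Let `f, h ∈ Λ = ℤ_p⟦T⟧` be non-zero with `μ(f·h) = 0`, and write `L = f·h`, `Lᵢ`, `fᵢ`, `hᵢ` for coefficients,
`v` for the `p`-adic valuation on `ℤ_p`. Suppose
* `λ(f) ≥ 3` and `v(f₀) ≥ 2` (on the arithmetic side: `f = f_X`, `λ(X) ≥ 3` from a layer `2`-Selmer count and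
  `v(f_X(0)) ≥ 2` from Greenberg's Euler-characteristic formula with `#Sel_{2^∞}(E/ℚ)` even);
* `v(L₀) = s`, `p^t ∣ L₁`, `v(L₂) = 1` with `s` EVEN and `s + 2 ≤ 2t` (on the arithmetic side: the first three
  coefficients of the Néron-normalised `p`-adic `L`-function, a finite certificate).
Then `h ∈ Λˣ` (`isUnit_of_slopePinch`), hence `(f·h) = (f)` (`span_mul_eq_span_of_slopePinch`).

In Newton-polygon language (not used in the proof): the polygon of `L` runs `(0,s) → (2,1) → (λ,0)`, so the
distinguished polynomial of `L` is (irreducible quadratic of slope `(s−1)/2`) × (irreducible of slope `1/(λ−2)`), and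
no proper factor over `ℤ_p` has an even constant-term valuation `≤ s − 2`; the proof below is the elementary
coefficient bookkeeping of exactly this, case by case on `λ(h) ∈ {≥ 2, 1}`:
`λ(h) ≥ 2` ⇒ `p² ∣ f₀h₂ + f₁h₁ + f₂h₀ = L₂` (contradiction); `λ(h) = 1` ⇒ `h₁ ∈ ℤ_pˣ`, `v(f₁) = 1` (from `L₂`),
and `L₁ = f₀h₁ + f₁h₀` has valuation `min(v(f₀), 1 + v(h₀))` (the two differ since `s = v(f₀) + v(h₀)` is even),
which is `< t` because `v(f₀) + (1 + v(h₀)) = s + 1 < 2t` (contradiction).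

WHY (numbers, not adjectives): it replaces the `λ`-pinch input `λ(X) ≥ λ_an` (a layer-`j` Selmer count with
`2^j ≥ λ_an`; infeasible at `λ_an = 12`, GEN 8 kit j262312) by `λ(X) ≥ 3` plus three analytic coefficient valuations,
all of which are on file for 412830t1 (the one door-level residue class of item 19923).

References: L. Washington, *Introduction to Cyclotomic Fields*, §7.1 (Weierstrass preparation; `μ`, `λ`);
R. Greenberg, V. Vatsal, Invent. Math. 142 (2000), p. 4 (equal invariants upgrade a divisibility to an equality);
N. Koblitz, *p-adic Numbers, p-adic Analysis, and Zeta-Functions*, IV.3 (Newton polygons; orientation only).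
-/

set_option autoImplicit false
set_option linter.dupNamespace false

noncomputable section

open scoped Classical

open Literature.NumberTheory.EllipticCurves Summit.BirchSwinnertonDyer.Rank1Residual.X1.MuLambda

namespace Summit.BirchSwinnertonDyer.BirchSwinnertonDyer.Theorems.SlopePinch

variable {p : ℕ} [Fact p.Prime]

/-! ## §1 Valuation bookkeeping in `ℤ_p` -/

/-- `p ^ v(x) ∣ x`. [folklore] -/
theorem pow_valuation_dvd (x : ℤ_[p]) : (p : ℤ_[p]) ^ x.valuation ∣ x := by
  by_cases hx : x = 0
  · rw [hx]; exact dvd_zero _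
  · exact (padicInt_pow_dvd_iff_le_valuation hx _).mpr le_rfl

/-- `p ∣ x ↔ 1 ≤ v(x)` for `x ≠ 0`. [folklore] -/
theorem dvd_iff_one_le_valuation {x : ℤ_[p]} (hx : x ≠ 0) :
    (p : ℤ_[p]) ∣ x ↔ 1 ≤ x.valuation := by
  rw [← padicInt_pow_dvd_iff_le_valuation hx 1, pow_one]

/-- `p ∣ x` in `ℤ_p` iff `x` is not a unit. [folklore] -/
theorem p_dvd_iff_not_isUnit (x : ℤ_[p]) : (p : ℤ_[p]) ∣ x ↔ ¬ IsUnit x := by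
  rw [← Ideal.mem_span_singleton, ← PadicInt.maximalIdeal_eq_span_p]
  exact IsLocalRing.mem_maximalIdeal x

/-- **Strict ultrametric inequality in `ℤ_p`**: if `v(x) < v(y)` (`x ≠ 0`) then `x + y ≠ 0` and
`v(x + y) = v(x)`. [folklore] -/
theorem valuation_add_eq_left {x y : ℤ_[p]} (hx : x ≠ 0) (hlt : x.valuation < y.valuation) :
    x + y ≠ 0 ∧ (x + y).valuation = x.valuation := by
  have hpy : (p : ℤ_[p]) ^ (x.valuation + 1) ∣ y := by
    by_cases hy : y = 0
    · rw [hy]; exact dvd_zero _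
    · exact (padicInt_pow_dvd_iff_le_valuation hy _).mpr hlt
  have hne : x + y ≠ 0 := by
    intro h0
    have hxy : x = -y := eq_neg_of_add_eq_zero_left h0
    have h' : (p : ℤ_[p]) ^ (x.valuation + 1) ∣ -y := (dvd_neg).mpr hpy
    rw [← hxy] at h'
    have := (padicInt_pow_dvd_iff_le_valuation hx _).mp h'
    omega
  refine ⟨hne, le_antisymm ?_ ?_⟩
  · by_contra hgt
    push Not at hgt
    have h1 : (p : ℤ_[p]) ^ (x.valuation + 1) ∣ x + y :=
      (padicInt_pow_dvd_iff_le_valuation hne _).mpr hgt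
    have h2 : (p : ℤ_[p]) ^ (x.valuation + 1) ∣ x := by
      have := dvd_sub h1 hpy
      rwa [add_sub_cancel_right] at this
    have := (padicInt_pow_dvd_iff_le_valuation hx _).mp h2
    omega
  · have h1 : (p : ℤ_[p]) ^ x.valuation ∣ x + y :=
      dvd_add (pow_valuation_dvd x) (dvd_trans (pow_dvd_pow _ (Nat.le_succ _)) hpy)
    exact (padicInt_pow_dvd_iff_le_valuation hne _).mp h1

/-! ## §2 Coefficients below / at `λ` of a `p`-free power series -/

/-- For `g ≠ 0` with `μ(g) = 0`: `pfree g = g` and `red g ≠ 0`. [folklore] -/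
theorem pfree_eq_self_of_mu_eq_zero {g : IwasawaAlgebra p} (hg : g ≠ 0) (hμ : mu g = 0) :
    pfree g = g ∧ red g ≠ 0 := by
  have h := eq_C_pow_mu_mul_pfree g
  rw [hμ, pow_zero, map_one, one_mul] at h
  exact ⟨h.symm, by rw [h]; exact red_pfree_ne_zero hg⟩

/-- For `g ≠ 0` with `μ(g) = 0`, `λ(g)` is the order of `g mod p`: `(red g).order = λ(g)`. [folklore] -/
theorem order_red_eq_lam {g : IwasawaAlgebra p} (hg : g ≠ 0) (hμ : mu g = 0) :
    (red g).order = (lam g : ℕ∞) := by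
  obtain ⟨hpf, hred⟩ := pfree_eq_self_of_mu_eq_zero hg hμ
  rw [lam, hpf]
  exact (ENat.coe_toNat (PowerSeries.order_finite_iff_ne_zero.mpr hred).ne).symm

/-- **Below `λ` the coefficients are divisible by `p`**: for `g ≠ 0`, `μ(g) = 0`, `i < λ(g)` ⇒ `p ∣ gᵢ`
(Weierstrass: `g ≡ T^{λ}·unit (mod p)`). [cite: Washington1997, §7.1] -/
theorem p_dvd_coeff_of_lt_lam {g : IwasawaAlgebra p} (hg : g ≠ 0) (hμ : mu g = 0) {i : ℕ}
    (hi : i < lam g) : (p : ℤ_[p]) ∣ PowerSeries.coeff i g := by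
  have hord := order_red_eq_lam hg hμ
  have hc : PowerSeries.coeff i (red g) = 0 :=
    PowerSeries.coeff_of_lt_order i (by rw [hord]; exact_mod_cast hi)
  rw [PowerSeries.coeff_map] at hc
  rw [p_dvd_iff_not_isUnit]
  intro hu
  exact (IsLocalRing.residue_ne_zero_iff_isUnit _).mpr hu hc

/-! ## §3 The first three coefficients of a product -/

/-- `(f·h)₀ = f₀·h₀`. [folklore] -/
theorem coeff_zero_mul' (f h : IwasawaAlgebra p) :
    PowerSeries.coeff 0 (f * h) = PowerSeries.coeff 0 f * PowerSeries.coeff 0 h := by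
  rw [PowerSeries.coeff_mul, Finset.Nat.antidiagonal_zero, Finset.sum_singleton]

/-- `(f·h)₁ = f₀·h₁ + f₁·h₀`. [folklore] -/
theorem coeff_one_mul' (f h : IwasawaAlgebra p) :
    PowerSeries.coeff 1 (f * h) =
      PowerSeries.coeff 0 f * PowerSeries.coeff 1 h + PowerSeries.coeff 1 f * PowerSeries.coeff 0 h := by
  rw [PowerSeries.coeff_mul, Finset.Nat.sum_antidiagonal_eq_sum_range_succ_mk, Finset.sum_range_succ,
    Finset.sum_range_succ, Finset.sum_range_zero, zero_add]

/-- `(f·h)₂ = f₀·h₂ + f₁·h₁ + f₂·h₀`. [folklore] -/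
theorem coeff_two_mul' (f h : IwasawaAlgebra p) :
    PowerSeries.coeff 2 (f * h) =
      PowerSeries.coeff 0 f * PowerSeries.coeff 2 h + PowerSeries.coeff 1 f * PowerSeries.coeff 1 h +
        PowerSeries.coeff 2 f * PowerSeries.coeff 0 h := by
  rw [PowerSeries.coeff_mul, Finset.Nat.sum_antidiagonal_eq_sum_range_succ_mk, Finset.sum_range_succ,
    Finset.sum_range_succ, Finset.sum_range_succ, Finset.sum_range_zero, zero_add]

/-! ## §4 The slope pinch -/

/-- **SLOPE PINCH (pure algebra).** `f, h ∈ Λ = ℤ_p⟦T⟧` non-zero, `μ(f·h) = 0`, `λ(f) ≥ 3`, `v(f₀) ≥ 2`; the product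
`L = f·h` has `v(L₀) = s` EVEN, `p^t ∣ L₁`, `v(L₂) = 1`, and `s + 2 ≤ 2t`. Then `h` is a unit of `Λ`.
Proof: `λ(h) ≥ 2` would give `p² ∣ L₂`; `λ(h) = 1` would give `v(f₁) = 1` and
`v(L₁) = min(v(f₀), 1 + v(h₀)) ≤ (s+1)/2 < t`; so `λ(h) = 0 = μ(h)`, i.e. `h ∈ Λˣ`.
[cite: Washington1997, §7.1 (Weierstrass preparation: units of Λ, μ and λ)]
[cite: GreenbergVatsal2000, p. 4 (after Thm. (1.2): equal invariants turn a divisibility into an equality)] -/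
theorem isUnit_of_slopePinch {f h : IwasawaAlgebra p} {s t : ℕ} (hf : f ≠ 0) (hh : h ≠ 0)
    (hμ : mu (f * h) = 0) (hlamf : 3 ≤ lam f) (hf0 : 2 ≤ (PowerSeries.coeff 0 f).valuation)
    (hL0 : PowerSeries.coeff 0 (f * h) ≠ 0) (hs : (PowerSeries.coeff 0 (f * h)).valuation = s)
    (hL1 : (p : ℤ_[p]) ^ t ∣ PowerSeries.coeff 1 (f * h))
    (hL2 : PowerSeries.coeff 2 (f * h) ≠ 0 ∧ (PowerSeries.coeff 2 (f * h)).valuation = 1)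
    (hse : Even s) (hst : s + 2 ≤ 2 * t) : IsUnit h := by
  -- `μ(f) = μ(h) = 0`
  have hμfh : mu f + mu h = 0 := by rw [← mu_mul hf hh]; exact hμ
  have hμf : mu f = 0 := by omega
  have hμh : mu h = 0 := by omega
  -- notation for coefficients
  set f0 := PowerSeries.coeff 0 f with hf0def
  set f1 := PowerSeries.coeff 1 f with hf1def
  set f2 := PowerSeries.coeff 2 f with hf2def
  set h0 := PowerSeries.coeff 0 h with hh0def
  set h1 := PowerSeries.coeff 1 h with hh1def
  set h2 := PowerSeries.coeff 2 h with hh2def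
  have hL0eq : PowerSeries.coeff 0 (f * h) = f0 * h0 := coeff_zero_mul' f h
  have hL1eq : PowerSeries.coeff 1 (f * h) = f0 * h1 + f1 * h0 := coeff_one_mul' f h
  have hL2eq : PowerSeries.coeff 2 (f * h) = f0 * h2 + f1 * h1 + f2 * h0 := coeff_two_mul' f h
  have hf00 : f0 ≠ 0 := fun h0 => hL0 (by rw [hL0eq, h0, zero_mul])
  have hh00 : h0 ≠ 0 := fun h0 => hL0 (by rw [hL0eq, h0, mul_zero])
  -- `p ∣ f₀, f₁, f₂` and `p² ∣ f₀`
  have hpf1 : (p : ℤ_[p]) ∣ f1 := p_dvd_coeff_of_lt_lam hf hμf (by omega)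
  have hpf2 : (p : ℤ_[p]) ∣ f2 := p_dvd_coeff_of_lt_lam hf hμf (by omega)
  have hp2f0 : (p : ℤ_[p]) ^ 2 ∣ f0 := (padicInt_pow_dvd_iff_le_valuation hf00 2).mpr hf0
  -- it suffices to show `λ(h) = 0`
  rw [isUnit_iff_mu_eq_zero_and_lam_eq_zero]
  refine ⟨hh, hμh, ?_⟩
  by_contra hlamh
  have hlamh1 : 1 ≤ lam h := Nat.one_le_iff_ne_zero.mpr hlamh
  have hph0 : (p : ℤ_[p]) ∣ h0 := p_dvd_coeff_of_lt_lam hh hμh (by omega)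
  -- `p² ∤ L₂`
  have hnot : ¬ (p : ℤ_[p]) ^ 2 ∣ PowerSeries.coeff 2 (f * h) := by
    intro hd
    have := (padicInt_pow_dvd_iff_le_valuation hL2.1 2).mp hd
    rw [hL2.2] at this
    omega
  have hp2_f0h2 : (p : ℤ_[p]) ^ 2 ∣ f0 * h2 := dvd_mul_of_dvd_left hp2f0 _
  have hp2_f2h0 : (p : ℤ_[p]) ^ 2 ∣ f2 * h0 := by rw [pow_two]; exact mul_dvd_mul hpf2 hph0
  rcases Nat.lt_or_ge 1 (lam h) with hlam2 | hlamle1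
  · -- case `λ(h) ≥ 2`: `p ∣ h₁`, so `p² ∣ L₂`
    have hph1 : (p : ℤ_[p]) ∣ h1 := p_dvd_coeff_of_lt_lam hh hμh hlam2
    have hp2_f1h1 : (p : ℤ_[p]) ^ 2 ∣ f1 * h1 := by rw [pow_two]; exact mul_dvd_mul hpf1 hph1
    exact hnot (by rw [hL2eq]; exact dvd_add (dvd_add hp2_f0h2 hp2_f1h1) hp2_f2h0)
  · -- case `λ(h) = 1`: `h₁` is a unit
    have hlamh_eq : lam h = 1 := le_antisymm hlamle1 hlamh1
    have hu1 : IsUnit h1 := by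
      -- at `λ(h) = 1` the coefficient is a unit (`h ≡ T·unit (mod p)`)
      obtain ⟨-, hred⟩ := pfree_eq_self_of_mu_eq_zero hh hμh
      have hord := order_red_eq_lam hh hμh
      have hc : PowerSeries.coeff (lam h) (red h) ≠ 0 := by
        have h' := PowerSeries.coeff_order hred
        rwa [hord, ENat.toNat_coe] at h'
      rw [PowerSeries.coeff_map, hlamh_eq] at hc
      exact (IsLocalRing.residue_ne_zero_iff_isUnit _).mp hc
    -- `p² ∤ f₁` (else `p² ∣ L₂`), hence `v(f₁) = 1`
    have hf10 : f1 ≠ 0 := by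
      intro h0
      exact hnot (by rw [hL2eq, h0, zero_mul, add_zero]; exact dvd_add hp2_f0h2 hp2_f2h0)
    have hvf1 : f1.valuation = 1 := by
      refine le_antisymm ?_ ((dvd_iff_one_le_valuation hf10).mp hpf1)
      by_contra hgt
      push Not at hgt
      have hp2f1 : (p : ℤ_[p]) ^ 2 ∣ f1 := (padicInt_pow_dvd_iff_le_valuation hf10 2).mpr hgt
      exact hnot (by
        rw [hL2eq]
        exact dvd_add (dvd_add hp2_f0h2 (dvd_mul_of_dvd_left hp2f1 _)) hp2_f2h0)
    -- valuations of the two summands of `L₁`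
    have hva : 1 ≤ h0.valuation := (dvd_iff_one_le_valuation hh00).mp hph0
    have hsum : f0.valuation + h0.valuation = s := by
      rw [← PadicInt.valuation_mul hf00 hh00, ← hL0eq]; exact hs
    have hv1 : (f0 * h1).valuation = f0.valuation := by
      rw [PadicInt.valuation_mul hf00 hu1.ne_zero, padicInt_valuation_eq_zero_of_isUnit hu1, add_zero]
    have hv2 : (f1 * h0).valuation = 1 + h0.valuation := by
      rw [PadicInt.valuation_mul hf10 hh00, hvf1]
    have hne1 : f0 * h1 ≠ 0 := mul_ne_zero hf00 hu1.ne_zero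
    have hne2 : f1 * h0 ≠ 0 := mul_ne_zero hf10 hh00
    -- the two valuations differ (else `s` is odd)
    have hdiff : f0.valuation ≠ 1 + h0.valuation := by
      intro heq
      have : s = 2 * h0.valuation + 1 := by omega
      rw [this] at hse
      exact Nat.not_even_two_mul_add_one _ hse
    -- so `v(L₁) = min`, and `p^t ∣ L₁` forces `t ≤ min`
    have hL1val : PowerSeries.coeff 1 (f * h) ≠ 0 ∧
        (PowerSeries.coeff 1 (f * h)).valuation = min f0.valuation (1 + h0.valuation) := by
      rw [hL1eq]
      rcases lt_or_gt_of_ne hdiff with hlt | hgt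
      · rw [min_eq_left hlt.le, ← hv1]
        exact valuation_add_eq_left hne1 (by rw [hv1, hv2]; exact hlt)
      · rw [min_eq_right hgt.le, ← hv2, add_comm (f0 * h1)]
        exact valuation_add_eq_left hne2 (by rw [hv1, hv2]; exact hgt)
    have ht : t ≤ min f0.valuation (1 + h0.valuation) := by
      rw [← hL1val.2]; exact (padicInt_pow_dvd_iff_le_valuation hL1val.1 t).mp hL1
    have ht1 : t ≤ f0.valuation := ht.trans (min_le_left _ _)
    have ht2 : t ≤ 1 + h0.valuation := ht.trans (min_le_right _ _)
    omega

/-- **SLOPE PINCH, ideal form**: under the hypotheses of `isUnit_of_slopePinch`, `(f·h) = (f)` in `Λ`.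
[cite: GreenbergVatsal2000, p. 4 (after Thm. (1.2))] -/
theorem span_mul_eq_span_of_slopePinch {f h : IwasawaAlgebra p} {s t : ℕ} (hf : f ≠ 0) (hh : h ≠ 0)
    (hμ : mu (f * h) = 0) (hlamf : 3 ≤ lam f) (hf0 : 2 ≤ (PowerSeries.coeff 0 f).valuation)
    (hL0 : PowerSeries.coeff 0 (f * h) ≠ 0) (hs : (PowerSeries.coeff 0 (f * h)).valuation = s)
    (hL1 : (p : ℤ_[p]) ^ t ∣ PowerSeries.coeff 1 (f * h))
    (hL2 : PowerSeries.coeff 2 (f * h) ≠ 0 ∧ (PowerSeries.coeff 2 (f * h)).valuation = 1)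
    (hse : Even s) (hst : s + 2 ≤ 2 * t) :
    Ideal.span ({f * h} : Set (IwasawaAlgebra p)) = Ideal.span {f} :=
  (span_eq_span_iff_isUnit hf rfl).mpr
    (isUnit_of_slopePinch hf hh hμ hlamf hf0 hL0 hs hL1 hL2 hse hst)

end Summit.BirchSwinnertonDyer.BirchSwinnertonDyer.Theorems.SlopePinch

end
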